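import Summits.AtomisticToContinuum.Crystallization.Theorems.FrustratedLawDichotomyStrainedPatchHomValueT2SoundQ
import Summits.AtomisticToContinuum.Crystallization.Theorems.FrustratedLawDichotomyStrainedPatchHomValueT2SoundE

/-!
# (I1) part R — ★★★ THE PER-LABEL SECOND-ORDER FLOOR ALONG THE JOINT SEGMENT (roadmap for `valueLeafT2J_sound`, step 4 = the analytic heart):
# for ONE recorded label (box record `Rb` on the full box, point record `Rp` at the centre) whose centre radius is off the junction radii,
# `W‖(V+ΔU)(q+Δξ)‖ ≥ W‖Vq‖ + β₀Σ_k ζ_k δ_k + ½Σ_kl (α₀ζ_kζ_l + β₀ν_kl) δ_kδ_l − ½·R0 − (1/6)·L`, where `R0` (value-hull class) is `accLabel`'s deviation charge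
# `Σ_kl max|I.hi−J.lo| |J.hi−I.lo| / SC · |δ_k||δ_l|` and `L` (Lipschitz class) is its sorted cubic `Σ_{a≤b≤m} μ · absHi(thirdOf Rb a b m)/SC · |δ_aδ_bδ_m|`
# — `…SoundE.expansion_floor_lipschitz` fed by parts N, P, Q (27623 `(H) HomFloor`, hcp half; decomp-a2c hand-1 g49; critic row 1674 (B) (I1) docket).

No definitions; 0 sorry; standard axioms; no instances / notation / `#eval`.  `--supports stmt-AtomisticToContinuum-27623`.
-/

noncomputable section

namespace Summit.AtomisticToContinuum.Crystallization.Theorems.FrustratedLawDichotomyStrainedPatchHomValueT2Kit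

open scoped BigOperators RealInnerProductSpace
open Finset
open Literature.Analysis.ValidatedNumerics.Numerics
open Summit.AtomisticToContinuum.Crystallization.Theorems.ChargedEnergyGapNegative (E3)
open Summit.AtomisticToContinuum.Crystallization.Theorems.FrustratedLawDichotomySchurCut (effPot w₄₅ ω₄)
open Summit.AtomisticToContinuum.Crystallization.Theorems.FrustratedLawDichotomyStrainedPatchTaylorLeaves (junctions)
open Summit.AtomisticToContinuum.Crystallization.Theorems.FrustratedLawDichotomyStrainedPatchHomEntryGramHcp (dot3 mem_dot3)
open Summit.AtomisticToContinuum.Crystallization.Theorems.FrustratedLawDichotomyStrainedPatchTaylorRegular (continuousOn_deriv_Wrec)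

/-! ## §1. Small bookkeeping -/

/-- Double sums supported below `top`. [formal bookkeeping] -/
theorem sum99_eq_sum_top {top : ℕ} (htop : top ≤ 9) {δ : ℕ → ℝ} (hδ : ∀ k, top ≤ k → k < 9 → δ k = 0) (F : ℕ → ℕ → ℝ) :
    ∑ k ∈ range 9, ∑ l ∈ range 9, F k l * (δ k * δ l) = ∑ k ∈ range top, ∑ l ∈ range top, F k l * (δ k * δ l) := by
  have inner : ∀ k, ∑ l ∈ range 9, F k l * (δ k * δ l) = ∑ l ∈ range top, F k l * (δ k * δ l) := fun k => by
    have := sum_range9_eq_sum_range htop hδ (fun l => F k l * δ k)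
    simpa only [mul_assoc] using this
  simp only [inner]
  have e : ∀ k, ∑ l ∈ range top, F k l * (δ k * δ l) = (∑ l ∈ range top, F k l * δ l) * δ k := fun k => by
    rw [Finset.sum_mul]; exact Finset.sum_congr rfl fun l _ => by ring
  simp only [e]
  exact sum_range9_eq_sum_range htop hδ _

/-- The entries of `V + tΔU` along `[0,1]` with `V`, `ΔU` read back: at `t = 0` the entry form of `V`. [formal bookkeeping] -/
theorem entries_at_zero (V ΔU : E3 →L[ℝ] E3) {EF : Fin 3 × Fin 3 → FI}
    (hEF : ∀ t ∈ Set.Icc (0 : ℝ) 1, ∀ ab : Fin 3 × Fin 3, FI.mem (((V + t • ΔU) (EuclideanSpace.single ab.2 (1 : ℝ))) ab.1) (EF ab))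
    (ab : Fin 3 × Fin 3) : FI.mem ((V (EuclideanSpace.single ab.2 (1 : ℝ))) ab.1) (EF ab) := by
  simpa using hEF 0 ⟨le_rfl, zero_le_one⟩ ab

/-! ## §2. ★★★ The per-label floor -/

/-- ★★★ **PER-LABEL SECOND-ORDER FLOOR ALONG THE JOINT SEGMENT.**  One label with argument path `q + tΔξ` under the frame path `V + tΔU`
(`ΔU` symmetric; `δ = dispN ΔU Δξ` vanishing from `top` on), recorded on the full box (`Rb`, entries/components along the whole segment) and at the centre
(`Rp`), centre radius off the junction radii.  Then the label's energy at the end point is bounded below by its second-order model at the centre minus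
`accLabel`'s class-dependent charge: value-hull deviation (`Rb.co.lip = false`) or the sorted Lipschitz cubic (`Rb.co.lip = true`).
[folklore chaining: `expansion_floor_lipschitz` + parts N/P/Q] -/
theorem label_floor (V ΔU : E3 →L[ℝ] E3) (q Δξ : E3) (hsym : ∀ a b : Fin 3, ent ΔU a b = ent ΔU b a) {top : ℕ} (htop : top ≤ 9)
    (maskX : Bool) (hmask : maskX = true → top ≤ 6) (hδ : ∀ k, top ≤ k → k < 9 → dispN ΔU Δξ k = 0)
    {EF EP : Fin 3 × Fin 3 → FI} {qF qP : Fin 3 → FI} {Rb Rp : DRec} (hRb : mkDRec top EF qF = some Rb) (hRp : mkDRec top EP qP = some Rp)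
    (hEF : ∀ t ∈ Set.Icc (0 : ℝ) 1, ∀ ab : Fin 3 × Fin 3, FI.mem (((V + t • ΔU) (EuclideanSpace.single ab.2 (1 : ℝ))) ab.1) (EF ab))
    (hqF : ∀ t ∈ Set.Icc (0 : ℝ) 1, ∀ c, FI.mem ((q + t • Δξ) c) (qF c))
    (hEP : ∀ ab : Fin 3 × Fin 3, FI.mem ((V (EuclideanSpace.single ab.2 (1 : ℝ))) ab.1) (EP ab)) (hqP : ∀ c, FI.mem (q c) (qP c))
    (hJ0 : ‖V q‖ ∉ junctions) :
    effPot w₄₅ ω₄ (3 / 400) ‖V q‖ +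
      deriv (effPot w₄₅ ω₄ (3 / 400)) ‖V q‖ / ‖V q‖ * ∑ k ∈ range top, zetaN V q k * dispN ΔU Δξ k +
      1 / 2 * ∑ k ∈ range top, ∑ l ∈ range top,
        ((deriv (deriv (effPot w₄₅ ω₄ (3 / 400))) ‖V q‖ - deriv (effPot w₄₅ ω₄ (3 / 400)) ‖V q‖ / ‖V q‖) / ‖V q‖ ^ 2 *
            (zetaN V q k * zetaN V q l) + deriv (effPot w₄₅ ω₄ (3 / 400)) ‖V q‖ / ‖V q‖ * nuR V q k l) * (dispN ΔU Δξ k * dispN ΔU Δξ l) -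
      1 / 2 * (if Rb.co.lip then 0 else ∑ k ∈ range top, ∑ l ∈ range top,
        ((max |((hessOf Rb maskX).getD (9 * k + l) fi0).hi - ((hessOf Rp maskX).getD (9 * k + l) fi0).lo|
              |((hessOf Rp maskX).getD (9 * k + l) fi0).hi - ((hessOf Rb maskX).getD (9 * k + l) fi0).lo| : ℤ) : ℝ) / SC *
          (|dispN ΔU Δξ k| * |dispN ΔU Δξ l|)) -
      1 / 6 * (if Rb.co.lip then ∑ a ∈ range top, ∑ b ∈ range top, ∑ m ∈ range top,
        (if a ≤ b ∧ b ≤ m then (if a = b then (if b = m then (1 : ℝ) else 3) else (if b = m then 3 else 6)) *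
          ((((thirdOf Rb a b m).absHi : ℤ) : ℝ) / SC * (|dispN ΔU Δξ a| * |dispN ΔU Δξ b| * |dispN ΔU Δξ m|)) else 0) else 0) ≤
      effPot w₄₅ ω₄ (3 / 400) ‖(V + ΔU) (q + Δξ)‖ := by
  have hS := SC_pos
  -- positivity and the squared-radius enclosures along the segment
  have hpos : ∀ t ∈ Set.Icc (0 : ℝ) 1, 0 < ‖(V + t • ΔU) (q + t • Δξ)‖ := fun t ht => norm_pos_of_mkDRec hRb _ _ (hEF t ht) (hqF t ht)
  have hI01 : (0 : ℝ) ∈ Set.Icc (0 : ℝ) 1 := ⟨le_rfl, zero_le_one⟩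
  have hpos0 : 0 < ‖V q‖ := norm_pos_of_mkDRec hRp V q hEP hqP
  have hcoF := mkDRec_coefL hRb
  have hcoP := mkDRec_coefL hRp
  have hQF : ∀ t ∈ Set.Icc (0 : ℝ) 1, FI.mem (‖(V + t • ΔU) (q + t • Δξ)‖ ^ 2) (dot3 (tab3 (yOf EF (tab3 qF))) (tab3 (yOf EF (tab3 qF)))) :=
    fun t ht => mem_labelQ _ _ (hEF t ht) (hqF t ht)
  have hQP : FI.mem (‖V q‖ ^ 2) (dot3 (tab3 (yOf EP (tab3 qP))) (tab3 (yOf EP (tab3 qP)))) := mem_labelQ V q hEP hqP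
  -- the path at `0` and `1`
  have e0V : V + (0 : ℝ) • ΔU = V := by ext x; simp
  have e0q : q + (0 : ℝ) • Δξ = q := by rw [zero_smul, add_zero]
  have e1V : V + (1 : ℝ) • ΔU = V + ΔU := by ext x; simp
  have e1q : q + (1 : ℝ) • Δξ = q + Δξ := by rw [one_smul]
  -- continuity of the path and of its radius
  have hyc : Continuous fun t : ℝ => (V + t • ΔU) (q + t • Δξ) :=
    continuous_iff_continuousAt.2 fun t => (hasDerivAt_labelPath V ΔU q Δξ t).continuousAt
  -- (1) first derivative on `[0,1]`
  have hg : ∀ t ∈ Set.Icc (0 : ℝ) 1, HasDerivAt (fun t : ℝ => effPot w₄₅ ω₄ (3 / 400) ‖(V + t • ΔU) (q + t • Δξ)‖)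
      (deriv (effPot w₄₅ ω₄ (3 / 400)) ‖(V + t • ΔU) (q + t • Δξ)‖ / ‖(V + t • ΔU) (q + t • Δξ)‖ *
        ∑ k ∈ range 9, zetaN (V + t • ΔU) (q + t • Δξ) k * dispN ΔU Δξ k) t :=
    fun t ht => hasDerivAt_W_label hsym (norm_ne_zero_iff.1 (hpos t ht).ne')
  -- (2) continuity of the first derivative on `[0,1]`
  have hg'c : ContinuousOn (fun t : ℝ => deriv (effPot w₄₅ ω₄ (3 / 400)) ‖(V + t • ΔU) (q + t • Δξ)‖ / ‖(V + t • ΔU) (q + t • Δξ)‖ *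
      ∑ k ∈ range 9, zetaN (V + t • ΔU) (q + t • Δξ) k * dispN ΔU Δξ k) (Set.Icc 0 1) := by
    intro t ht
    have hρc : ContinuousAt (fun t : ℝ => ‖(V + t • ΔU) (q + t • Δξ)‖) t := (hyc.norm).continuousAt
    have hW' : ContinuousAt (fun t : ℝ => deriv (effPot w₄₅ ω₄ (3 / 400)) ‖(V + t • ΔU) (q + t • Δξ)‖) t :=
      ContinuousAt.comp (g := deriv (effPot w₄₅ ω₄ (3 / 400))) (continuousOn_deriv_Wrec.continuousAt (Ioi_mem_nhds (hpos t ht))) hρc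
    have hSd : HasDerivAt (fun t : ℝ => ∑ k ∈ range 9, zetaN (V + t • ΔU) (q + t • Δξ) k * dispN ΔU Δξ k)
        (∑ k ∈ range 9, (∑ m ∈ range 9, nuR (V + t • ΔU) (q + t • Δξ) k m * dispN ΔU Δξ m) * dispN ΔU Δξ k) t :=
      HasDerivAt.fun_sum fun k hk => (hasDerivAt_zetaN_path V ΔU q Δξ hsym (Finset.mem_range.1 hk) t).mul_const _
    exact ((hW'.div hρc (hpos t ht).ne').mul hSd.continuousAt).continuousWithinAt
  -- (3) the exceptional parameters
  set X : Finset ℝ := (finite_label_junctions V ΔU q Δξ hJ0).toFinset with hX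
  have hXJ : ∀ t, t ∉ X → ‖(V + t • ΔU) (q + t • Δξ)‖ ∉ junctions := fun t ht hmem =>
    ht (by rw [hX, Set.Finite.mem_toFinset]; exact hmem)
  -- (4) the second derivative off `X`
  have hg'' : ∀ t ∈ Set.Ioo (0 : ℝ) 1, t ∉ X →
      HasDerivAt (fun t : ℝ => deriv (effPot w₄₅ ω₄ (3 / 400)) ‖(V + t • ΔU) (q + t • Δξ)‖ / ‖(V + t • ΔU) (q + t • Δξ)‖ *
          ∑ k ∈ range 9, zetaN (V + t • ΔU) (q + t • Δξ) k * dispN ΔU Δξ k)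
        (∑ k ∈ range 9, ∑ l ∈ range 9,
          ((deriv (deriv (effPot w₄₅ ω₄ (3 / 400))) ‖(V + t • ΔU) (q + t • Δξ)‖ -
              deriv (effPot w₄₅ ω₄ (3 / 400)) ‖(V + t • ΔU) (q + t • Δξ)‖ / ‖(V + t • ΔU) (q + t • Δξ)‖) / ‖(V + t • ΔU) (q + t • Δξ)‖ ^ 2 *
              (zetaN (V + t • ΔU) (q + t • Δξ) k * zetaN (V + t • ΔU) (q + t • Δξ) l) +
            deriv (effPot w₄₅ ω₄ (3 / 400)) ‖(V + t • ΔU) (q + t • Δξ)‖ / ‖(V + t • ΔU) (q + t • Δξ)‖ * nuR (V + t • ΔU) (q + t • Δξ) k l) *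
          (dispN ΔU Δξ k * dispN ΔU Δξ l)) t :=
    fun t ht htX => hasDerivAt_slope_label hsym (hpos t (Set.Ioo_subset_Icc_self ht)) (hXJ t htX)
  -- per-parameter Hessian-entry data: memberships in the box table (off the junctions) and the point table (at the centre)
  have hHbox : ∀ t ∈ Set.Icc (0 : ℝ) 1, ‖(V + t • ΔU) (q + t • Δξ)‖ ∉ junctions → ∀ k l, k < top → l < top →
      FI.mem ((deriv (deriv (effPot w₄₅ ω₄ (3 / 400))) ‖(V + t • ΔU) (q + t • Δξ)‖ -
              deriv (effPot w₄₅ ω₄ (3 / 400)) ‖(V + t • ΔU) (q + t • Δξ)‖ / ‖(V + t • ΔU) (q + t • Δξ)‖) / ‖(V + t • ΔU) (q + t • Δξ)‖ ^ 2 *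
            (zetaN (V + t • ΔU) (q + t • Δξ) k * zetaN (V + t • ΔU) (q + t • Δξ) l) +
          deriv (effPot w₄₅ ω₄ (3 / 400)) ‖(V + t • ΔU) (q + t • Δξ)‖ / ‖(V + t • ΔU) (q + t • Δξ)‖ * nuR (V + t • ΔU) (q + t • Δξ) k l)
        ((hessOf Rb maskX).getD (9 * k + l) fi0) := by
    intro t ht hJt k l hk hl
    obtain ⟨mal, mbe⟩ := mem_coefL (hpos t ht) hJt (hQF t ht) hcoF
    obtain ⟨_, _, hζ, hν⟩ := mem_mkDRec htop hRb (V + t • ΔU) (q + t • Δξ) (hEF t ht) (hqF t ht)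
    exact mem_hessOf htop hmask mal mbe hζ hν (nuR_symm _ _) hk hl
  have hHpt : ∀ k l, k < top → l < top →
      FI.mem ((deriv (deriv (effPot w₄₅ ω₄ (3 / 400))) ‖V q‖ - deriv (effPot w₄₅ ω₄ (3 / 400)) ‖V q‖ / ‖V q‖) / ‖V q‖ ^ 2 *
            (zetaN V q k * zetaN V q l) + deriv (effPot w₄₅ ω₄ (3 / 400)) ‖V q‖ / ‖V q‖ * nuR V q k l)
        ((hessOf Rp maskX).getD (9 * k + l) fi0) := by
    intro k l hk hl
    obtain ⟨mal, mbe⟩ := mem_coefL hpos0 hJ0 hQP hcoP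
    obtain ⟨_, _, hζ, hν⟩ := mem_mkDRec htop hRp V q hEP hqP
    exact mem_hessOf htop hmask mal mbe hζ hν (nuR_symm _ _) hk hl
  -- the quadratic form of the Hessian along the segment, truncated to `top`
  set Qf : ℝ → ℝ := fun t => ∑ k ∈ range top, ∑ l ∈ range top,
      ((deriv (deriv (effPot w₄₅ ω₄ (3 / 400))) ‖(V + t • ΔU) (q + t • Δξ)‖ -
          deriv (effPot w₄₅ ω₄ (3 / 400)) ‖(V + t • ΔU) (q + t • Δξ)‖ / ‖(V + t • ΔU) (q + t • Δξ)‖) / ‖(V + t • ΔU) (q + t • Δξ)‖ ^ 2 *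
          (zetaN (V + t • ΔU) (q + t • Δξ) k * zetaN (V + t • ΔU) (q + t • Δξ) l) +
        deriv (effPot w₄₅ ω₄ (3 / 400)) ‖(V + t • ΔU) (q + t • Δξ)‖ / ‖(V + t • ΔU) (q + t • Δξ)‖ * nuR (V + t • ΔU) (q + t • Δξ) k l) *
      (dispN ΔU Δξ k * dispN ΔU Δξ l) with hQf
  -- the value-hull charge and the Lipschitz cubic
  set R0 : ℝ := ∑ k ∈ range top, ∑ l ∈ range top,
      ((max |((hessOf Rb maskX).getD (9 * k + l) fi0).hi - ((hessOf Rp maskX).getD (9 * k + l) fi0).lo|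
            |((hessOf Rp maskX).getD (9 * k + l) fi0).hi - ((hessOf Rb maskX).getD (9 * k + l) fi0).lo| : ℤ) : ℝ) / SC *
        (|dispN ΔU Δξ k| * |dispN ΔU Δξ l|) with hR0
  set L : ℝ := ∑ a ∈ range top, ∑ b ∈ range top, ∑ m ∈ range top,
      (if a ≤ b ∧ b ≤ m then (if a = b then (if b = m then (1 : ℝ) else 3) else (if b = m then 3 else 6)) *
        ((((thirdOf Rb a b m).absHi : ℤ) : ℝ) / SC * (|dispN ΔU Δξ a| * |dispN ΔU Δξ b| * |dispN ΔU Δξ m|)) else 0) with hL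
  -- (5) the lower bound of the second derivative, by class
  have hbound : ∀ t ∈ Set.Ioo (0 : ℝ) 1, t ∉ X →
      (Qf 0 - (if Rb.co.lip then 0 else R0)) - (if Rb.co.lip then L else 0) * t ≤
        ∑ k ∈ range 9, ∑ l ∈ range 9,
          ((deriv (deriv (effPot w₄₅ ω₄ (3 / 400))) ‖(V + t • ΔU) (q + t • Δξ)‖ -
              deriv (effPot w₄₅ ω₄ (3 / 400)) ‖(V + t • ΔU) (q + t • Δξ)‖ / ‖(V + t • ΔU) (q + t • Δξ)‖) / ‖(V + t • ΔU) (q + t • Δξ)‖ ^ 2 *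
              (zetaN (V + t • ΔU) (q + t • Δξ) k * zetaN (V + t • ΔU) (q + t • Δξ) l) +
            deriv (effPot w₄₅ ω₄ (3 / 400)) ‖(V + t • ΔU) (q + t • Δξ)‖ / ‖(V + t • ΔU) (q + t • Δξ)‖ * nuR (V + t • ΔU) (q + t • Δξ) k l) *
          (dispN ΔU Δξ k * dispN ΔU Δξ l) := by
    intro t ht htX
    have htI : t ∈ Set.Icc (0 : ℝ) 1 := Set.Ioo_subset_Icc_self ht
    rw [sum99_eq_sum_top htop hδ]
    change (Qf 0 - (if Rb.co.lip then 0 else R0)) - (if Rb.co.lip then L else 0) * t ≤ Qf t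
    by_cases hlip : Rb.co.lip = true
    · -- Lipschitz class: mean value theorem on `Qf` with the sorted cubic bound of its derivative
      simp only [hlip, if_true, sub_zero]
      -- derivative of `Qf` on `[0,1]`
      have hQd : ∀ s ∈ Set.Icc (0 : ℝ) 1, ∃ a₁ : ℝ, FI.mem a₁ Rb.co.a1 ∧
          HasDerivAt Qf (∑ k ∈ range top, ∑ l ∈ range top, (∑ m ∈ range 9,
            (zetaN (V + s • ΔU) (q + s • Δξ) m *
                  (a₁ * (zetaN (V + s • ΔU) (q + s • Δξ) k * zetaN (V + s • ΔU) (q + s • Δξ) l) +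
                    (deriv (deriv (effPot w₄₅ ω₄ (3 / 400))) ‖(V + s • ΔU) (q + s • Δξ)‖ -
                          deriv (effPot w₄₅ ω₄ (3 / 400)) ‖(V + s • ΔU) (q + s • Δξ)‖ / ‖(V + s • ΔU) (q + s • Δξ)‖) /
                        ‖(V + s • ΔU) (q + s • Δξ)‖ ^ 2 * nuR (V + s • ΔU) (q + s • Δξ) k l) +
                (deriv (deriv (effPot w₄₅ ω₄ (3 / 400))) ‖(V + s • ΔU) (q + s • Δξ)‖ -
                      deriv (effPot w₄₅ ω₄ (3 / 400)) ‖(V + s • ΔU) (q + s • Δξ)‖ / ‖(V + s • ΔU) (q + s • Δξ)‖) / ‖(V + s • ΔU) (q + s • Δξ)‖ ^ 2 *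
                    nuR (V + s • ΔU) (q + s • Δξ) k m * zetaN (V + s • ΔU) (q + s • Δξ) l +
                (deriv (deriv (effPot w₄₅ ω₄ (3 / 400))) ‖(V + s • ΔU) (q + s • Δξ)‖ -
                      deriv (effPot w₄₅ ω₄ (3 / 400)) ‖(V + s • ΔU) (q + s • Δξ)‖ / ‖(V + s • ΔU) (q + s • Δξ)‖) / ‖(V + s • ΔU) (q + s • Δξ)‖ ^ 2 *
                    nuR (V + s • ΔU) (q + s • Δξ) l m * zetaN (V + s • ΔU) (q + s • Δξ) k +
                deriv (effPot w₄₅ ω₄ (3 / 400)) ‖(V + s • ΔU) (q + s • Δξ)‖ / ‖(V + s • ΔU) (q + s • Δξ)‖ *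
                  (∑ cc : Fin 3, (dyR (V + s • ΔU) (q + s • Δξ) l cc * ddyR m k cc + dyR (V + s • ΔU) (q + s • Δξ) k cc * ddyR m l cc +
                    dyR (V + s • ΔU) (q + s • Δξ) m cc * ddyR k l cc))) *
              dispN ΔU Δξ m) * (dispN ΔU Δξ k * dispN ΔU Δξ l)) s ∧
          ∀ a b m, a < top → b < top → m < top →
            FI.mem (zetaN (V + s • ΔU) (q + s • Δξ) m *
                  (a₁ * (zetaN (V + s • ΔU) (q + s • Δξ) a * zetaN (V + s • ΔU) (q + s • Δξ) b) +
                    (deriv (deriv (effPot w₄₅ ω₄ (3 / 400))) ‖(V + s • ΔU) (q + s • Δξ)‖ -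
                          deriv (effPot w₄₅ ω₄ (3 / 400)) ‖(V + s • ΔU) (q + s • Δξ)‖ / ‖(V + s • ΔU) (q + s • Δξ)‖) /
                        ‖(V + s • ΔU) (q + s • Δξ)‖ ^ 2 * nuR (V + s • ΔU) (q + s • Δξ) a b) +
                (deriv (deriv (effPot w₄₅ ω₄ (3 / 400))) ‖(V + s • ΔU) (q + s • Δξ)‖ -
                      deriv (effPot w₄₅ ω₄ (3 / 400)) ‖(V + s • ΔU) (q + s • Δξ)‖ / ‖(V + s • ΔU) (q + s • Δξ)‖) / ‖(V + s • ΔU) (q + s • Δξ)‖ ^ 2 *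
                    nuR (V + s • ΔU) (q + s • Δξ) a m * zetaN (V + s • ΔU) (q + s • Δξ) b +
                (deriv (deriv (effPot w₄₅ ω₄ (3 / 400))) ‖(V + s • ΔU) (q + s • Δξ)‖ -
                      deriv (effPot w₄₅ ω₄ (3 / 400)) ‖(V + s • ΔU) (q + s • Δξ)‖ / ‖(V + s • ΔU) (q + s • Δξ)‖) / ‖(V + s • ΔU) (q + s • Δξ)‖ ^ 2 *
                    nuR (V + s • ΔU) (q + s • Δξ) b m * zetaN (V + s • ΔU) (q + s • Δξ) a +
                deriv (effPot w₄₅ ω₄ (3 / 400)) ‖(V + s • ΔU) (q + s • Δξ)‖ / ‖(V + s • ΔU) (q + s • Δξ)‖ *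
                  (∑ cc : Fin 3, (dyR (V + s • ΔU) (q + s • Δξ) b cc * ddyR m a cc + dyR (V + s • ΔU) (q + s • Δξ) a cc * ddyR m b cc +
                    dyR (V + s • ΔU) (q + s • Δξ) m cc * ddyR a b cc)))
              (thirdOf Rb a b m) := by
        intro s hs
        obtain ⟨hreg, hJs, mal, mbe, ⟨a₁, ma1, hαd⟩, hβd⟩ := coefL_lip (hpos s hs) (hQF s hs) hcoF hlip
        refine ⟨a₁, ma1, ?_, fun a b m ha hb hm => mem_thirdOf htop hRb _ _ (hEF s hs) (hqF s hs) ma1 mal mbe ha hb hm⟩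
        simp only [hQf]
        exact HasDerivAt.fun_sum fun k hk => HasDerivAt.fun_sum fun l hl =>
          (hasDerivAt_hessEntry_label hsym (Finset.mem_range.1 hk |>.trans_le htop) (Finset.mem_range.1 hl |>.trans_le htop) (hpos s hs)
            hαd hβd).mul_const _
      -- the derivative is bounded by `L`
      have hMVT := norm_image_sub_le_of_norm_deriv_le_segment' (f := Qf) (a := 0) (b := 1)
        (f' := fun s => deriv Qf s) (C := L) (fun s hs => by
          obtain ⟨a₁, _, hd, _⟩ := hQd s hs
          exact hd.differentiableAt.hasDerivAt.hasDerivWithinAt) (fun s hs => by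
          have hsI : s ∈ Set.Icc (0 : ℝ) 1 := Set.Ico_subset_Icc_self hs
          obtain ⟨a₁, ma1, hd, hT⟩ := hQd s hsI
          rw [hd.deriv, Real.norm_eq_abs]
          -- rewrite the derivative as the ordered cubic, then apply the sorted bound
          have ecut : ∀ k l, (∑ m ∈ range 9, (zetaN (V + s • ΔU) (q + s • Δξ) m *
                  (a₁ * (zetaN (V + s • ΔU) (q + s • Δξ) k * zetaN (V + s • ΔU) (q + s • Δξ) l) +
                    (deriv (deriv (effPot w₄₅ ω₄ (3 / 400))) ‖(V + s • ΔU) (q + s • Δξ)‖ -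
                          deriv (effPot w₄₅ ω₄ (3 / 400)) ‖(V + s • ΔU) (q + s • Δξ)‖ / ‖(V + s • ΔU) (q + s • Δξ)‖) /
                        ‖(V + s • ΔU) (q + s • Δξ)‖ ^ 2 * nuR (V + s • ΔU) (q + s • Δξ) k l) +
                (deriv (deriv (effPot w₄₅ ω₄ (3 / 400))) ‖(V + s • ΔU) (q + s • Δξ)‖ -
                      deriv (effPot w₄₅ ω₄ (3 / 400)) ‖(V + s • ΔU) (q + s • Δξ)‖ / ‖(V + s • ΔU) (q + s • Δξ)‖) / ‖(V + s • ΔU) (q + s • Δξ)‖ ^ 2 *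
                    nuR (V + s • ΔU) (q + s • Δξ) k m * zetaN (V + s • ΔU) (q + s • Δξ) l +
                (deriv (deriv (effPot w₄₅ ω₄ (3 / 400))) ‖(V + s • ΔU) (q + s • Δξ)‖ -
                      deriv (effPot w₄₅ ω₄ (3 / 400)) ‖(V + s • ΔU) (q + s • Δξ)‖ / ‖(V + s • ΔU) (q + s • Δξ)‖) / ‖(V + s • ΔU) (q + s • Δξ)‖ ^ 2 *
                    nuR (V + s • ΔU) (q + s • Δξ) l m * zetaN (V + s • ΔU) (q + s • Δξ) k +
                deriv (effPot w₄₅ ω₄ (3 / 400)) ‖(V + s • ΔU) (q + s • Δξ)‖ / ‖(V + s • ΔU) (q + s • Δξ)‖ *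
                  (∑ cc : Fin 3, (dyR (V + s • ΔU) (q + s • Δξ) l cc * ddyR m k cc + dyR (V + s • ΔU) (q + s • Δξ) k cc * ddyR m l cc +
                    dyR (V + s • ΔU) (q + s • Δξ) m cc * ddyR k l cc))) *
              dispN ΔU Δξ m) * (dispN ΔU Δξ k * dispN ΔU Δξ l) =
              ∑ m ∈ range top, (zetaN (V + s • ΔU) (q + s • Δξ) m *
                  (a₁ * (zetaN (V + s • ΔU) (q + s • Δξ) k * zetaN (V + s • ΔU) (q + s • Δξ) l) +
                    (deriv (deriv (effPot w₄₅ ω₄ (3 / 400))) ‖(V + s • ΔU) (q + s • Δξ)‖ -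
                          deriv (effPot w₄₅ ω₄ (3 / 400)) ‖(V + s • ΔU) (q + s • Δξ)‖ / ‖(V + s • ΔU) (q + s • Δξ)‖) /
                        ‖(V + s • ΔU) (q + s • Δξ)‖ ^ 2 * nuR (V + s • ΔU) (q + s • Δξ) k l) +
                (deriv (deriv (effPot w₄₅ ω₄ (3 / 400))) ‖(V + s • ΔU) (q + s • Δξ)‖ -
                      deriv (effPot w₄₅ ω₄ (3 / 400)) ‖(V + s • ΔU) (q + s • Δξ)‖ / ‖(V + s • ΔU) (q + s • Δξ)‖) / ‖(V + s • ΔU) (q + s • Δξ)‖ ^ 2 *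
                    nuR (V + s • ΔU) (q + s • Δξ) k m * zetaN (V + s • ΔU) (q + s • Δξ) l +
                (deriv (deriv (effPot w₄₅ ω₄ (3 / 400))) ‖(V + s • ΔU) (q + s • Δξ)‖ -
                      deriv (effPot w₄₅ ω₄ (3 / 400)) ‖(V + s • ΔU) (q + s • Δξ)‖ / ‖(V + s • ΔU) (q + s • Δξ)‖) / ‖(V + s • ΔU) (q + s • Δξ)‖ ^ 2 *
                    nuR (V + s • ΔU) (q + s • Δξ) l m * zetaN (V + s • ΔU) (q + s • Δξ) k +
                deriv (effPot w₄₅ ω₄ (3 / 400)) ‖(V + s • ΔU) (q + s • Δξ)‖ / ‖(V + s • ΔU) (q + s • Δξ)‖ *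
                  (∑ cc : Fin 3, (dyR (V + s • ΔU) (q + s • Δξ) l cc * ddyR m k cc + dyR (V + s • ΔU) (q + s • Δξ) k cc * ddyR m l cc +
                    dyR (V + s • ΔU) (q + s • Δξ) m cc * ddyR k l cc))) *
              (dispN ΔU Δξ k * dispN ΔU Δξ l * dispN ΔU Δξ m) := by
            intro k l
            rw [sum_range9_eq_sum_range htop hδ, Finset.sum_mul]
            exact Finset.sum_congr rfl fun m _ => by ring
          simp only [ecut]
          exact cubic_le_sorted Rb _ (fun k l m => thirdR_symm12 _ _ _ _ _ k l m) (fun k l m => thirdR_symm23 _ _ _ _ _ k l m) hT _)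
      have key := hMVT t htI
      rw [Real.norm_eq_abs, sub_zero] at key
      have := (abs_sub_le_iff.1 key).2
      linarith
    · -- value-hull class: entrywise deviation between the box table and the point table
      have hlip' : Rb.co.lip = false := by simpa using hlip
      simp only [hlip', Bool.false_eq_true, if_false, zero_mul, sub_zero]
      show Qf 0 - R0 ≤ Qf t
      simp only [hQf, hR0, e0V, e0q, ← Finset.sum_sub_distrib]
      refine Finset.sum_le_sum fun k hk => Finset.sum_le_sum fun l hl => ?_
      have hk' := Finset.mem_range.1 hk
      have hl' := Finset.mem_range.1 hl
      exact mul_ge_of_abs_sub_le (abs_sub_le_of_mem_mem (hHbox t htI (hXJ t htX) k l hk' hl') (hHpt k l hk' hl'))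
  -- (6) the tangent cubic
  have hfloor := expansion_floor_lipschitz X hg hg'c hg'' hbound
  simp only [e0V, e0q, e1V, e1q] at hfloor
  rw [sum_range9_eq_sum_range htop hδ] at hfloor
  have hQ0 : Qf 0 = ∑ k ∈ range top, ∑ l ∈ range top,
      ((deriv (deriv (effPot w₄₅ ω₄ (3 / 400))) ‖V q‖ - deriv (effPot w₄₅ ω₄ (3 / 400)) ‖V q‖ / ‖V q‖) / ‖V q‖ ^ 2 *
          (zetaN V q k * zetaN V q l) + deriv (effPot w₄₅ ω₄ (3 / 400)) ‖V q‖ / ‖V q‖ * nuR V q k l) * (dispN ΔU Δξ k * dispN ΔU Δξ l) := by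
    simp only [hQf, e0V, e0q]
  rw [hQ0] at hfloor
  by_cases hlip : Rb.co.lip = true
  · simp only [hlip, if_true] at hfloor ⊢
    linarith
  · have hlip' : Rb.co.lip = false := by simpa using hlip
    simp only [hlip'] at hfloor ⊢
    simp only [Bool.false_eq_true, if_false] at hfloor ⊢
    linarith

end Summit.AtomisticToContinuum.Crystallization.Theorems.FrustratedLawDichotomyStrainedPatchHomValueT2Kit
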